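import Literature.NumberTheory.EllipticCurves.PNewBranchGaloisLattice
import HarnessLib

/-!
# [telescope — width x2-p2 g24, 2026-08-30] DESCENT OF CONJUGACY («Schur descent» of T-An-2ᵍ's transcription step (D5), with NO
# irreducibility input): matrix families with entries in a field `F` that are conjugate over an extension field `E ⊇ F` are
# conjugate over `F` itself as soon as `F` is infinite — so the fibre clauses (G-fib₀)/(G-fib_t) of `IsBranchGaloisLattice` may be
# READ OVER `Ω = ℚ̄_p` (Hida 1986 Thm. 2.1 (2.2c): «`π mod P_f` is equivalent to `π(f)` as a Galois representation into `GL₂(Ω)`»)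
# and still give the registered clauses over `ℚ_p` / `K_t`.
# Crux 4 `BSDpOnCellC` (stmt-BirchSwinnertonDyer-19034), line «telescope», named fact T-An-2ᵍ (`--supports`, helper; closes nothing)

WHY: after telescope v17 the ONE load-bearing named fact of the line is the assembled T-An-2ᵍ
`Literature.NumberTheory.EllipticCurves.hida1986_castella2020_exists_galoisLattice_on_pNewBranchChart`, whose transcription step (D5)
(module docstring of `PNewBranchGaloisLattice`) passes from Hida's conjugacy over `Ω` to conjugacy over the residue FIELD `ℚ_p` / `K_t` by
«Ribet's irreducibility and Schur». THIS FILE PROVES THAT STEP AS A TREE THEOREM, and in a form that needs NO irreducibility: if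
`A_i^E · P = P · B_i^E` for all `i` with `P ∈ GL_n(E)` and `A_i, B_i ∈ M_n(F)`, then some `Q ∈ GL_n(F)` has `A_i · Q = Q · B_i` for all `i`
(proof: every `F`-linear coordinate `φ : E → F` of `P` is an intertwiner `P.map φ`; `P` is an `E`-combination of finitely many of them, so the
determinant polynomial `det(Σ y_k · P.map φ_k) ∈ F[y]` does not vanish at the `E`-point of coordinates of `P`, hence — `F` being infinite —
not at some `F`-point either). Consequently a de-assembled re-typing of T-An-2ᵍ may state (G-fib₀)/(G-fib_t) verbatim over `Ω = PadicAlgCl p`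
(§3: `fib0_of_conjOver`, `fibt_of_conjOver`, `isBranchGaloisLattice_of_conjOver`), one print step closer to [Hida1986, Thm. 2.1 (2.2c)].

CONTENT (namespace `…Theorems.TelescopeBranchConjDescent`; THEOREMS ONLY): §1 `map_mul_map_algebraMap_left/right` (coordinates of
`A^E P`, `P B^E`); §2 **`exists_conj_descent`** (matrix form, `det ≠ 0`), **`exists_conj_descent_GL`** (`A_i = Q B_i Q⁻¹` form); §3 the
three Summits bridges for `IsBranchGaloisLattice`.

HONEST FRAMING: linear algebra over fields; constructs no Galois representation; closes no registered stub, no crux, no summit statement;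
BSD is proved for no curve by this file. No named fact, no definition, no instance, no `sorry`.
References (shape only): [cite: Hida1986, §2 Terminology (p. 558) and Thm. 2.1 (2.2c) (p. 559)]
-/

set_option autoImplicit false
set_option linter.dupNamespace false

noncomputable section

open scoped Classical MatrixGroups PowerSeries.WithPiTopology
open Finset
open Literature.NumberTheory.EllipticCurves Literature.NumberTheory.EllipticCurves.GreenbergSelmer
  Literature.NumberTheory.EllipticCurves.ModularForms Literature.NumberTheory.GaloisRepresentations

namespace Summit.BirchSwinnertonDyer.BirchSwinnertonDyer.Theorems.TelescopeBranchConjDescent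

universe u v w

/-! ### §1. Coordinates of `A^E · P` and `P · B^E` along an `F`-linear functional -/

section LinearAlgebra

variable {F : Type u} {E : Type v} [Field F] [Field E] [Algebra F E] {n : Type w} [Fintype n] [DecidableEq n]

omit [DecidableEq n] in
/-- For an `F`-linear `φ : E → F` and `A ∈ M_n(F)`: the `φ`-coordinate of `A^E · P` is `A · (φ-coordinate of P)`. [folklore] -/
theorem map_mul_map_algebraMap_left (φ : E →ₗ[F] F) (A : Matrix n n F) (P : Matrix n n E) :
    (A.map (algebraMap F E) * P).map φ = A * P.map φ := by
  ext i j
  simp only [Matrix.map_apply, Matrix.mul_apply, map_sum]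
  refine Finset.sum_congr rfl fun t _ => ?_
  rw [← Algebra.smul_def, map_smul, smul_eq_mul]

omit [DecidableEq n] in
/-- For an `F`-linear `φ : E → F` and `B ∈ M_n(F)`: the `φ`-coordinate of `P · B^E` is `(φ-coordinate of P) · B`. [folklore] -/
theorem map_mul_map_algebraMap_right (φ : E →ₗ[F] F) (P : Matrix n n E) (B : Matrix n n F) :
    (P * B.map (algebraMap F E)).map φ = P.map φ * B := by
  ext i j
  simp only [Matrix.map_apply, Matrix.mul_apply, map_sum]
  refine Finset.sum_congr rfl fun t _ => ?_
  rw [mul_comm, ← Algebra.smul_def, map_smul, smul_eq_mul, mul_comm]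

/-! ### §2. Descent of conjugacy from an extension field to an infinite ground field -/

/-- **Descent of conjugacy (matrix form).** `F ⊆ E` fields, `F` infinite; if `A_i^E · P = P · B_i^E` for every `i`, with `det P ≠ 0` and
`A_i, B_i ∈ M_n(F)`, then `A_i · Q = Q · B_i` for every `i` for some `Q ∈ M_n(F)` with `det Q ≠ 0`. No hypothesis on the families
(no irreducibility, any index type). [folklore] -/
theorem exists_conj_descent [Infinite F] {ι : Type*} (A B : ι → Matrix n n F) (P : Matrix n n E) (hP : P.det ≠ 0)
    (h : ∀ i, (A i).map (algebraMap F E) * P = P * (B i).map (algebraMap F E)) :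
    ∃ Q : Matrix n n F, Q.det ≠ 0 ∧ ∀ i, A i * Q = Q * B i := by
  classical
  -- an `F`-basis of `E` and the coordinate functionals
  let b := Module.Basis.ofVectorSpace F E
  let coord : Module.Basis.ofVectorSpaceIndex F E → (E →ₗ[F] F) := fun k => (Finsupp.lapply k).comp b.repr.toLinearMap
  have hcoord : ∀ k (z : E), coord k z = b.repr z k := fun k z => rfl
  -- every coordinate of `P` is an intertwiner over `F`
  let Q : Module.Basis.ofVectorSpaceIndex F E → Matrix n n F := fun k => P.map (coord k)
  have hQ : ∀ k i, A i * Q k = Q k * B i := by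
    intro k i
    change A i * P.map (coord k) = P.map (coord k) * B i
    rw [← map_mul_map_algebraMap_left, h i, map_mul_map_algebraMap_right]
  -- the finitely many coordinates that occur in `P`
  let T : Finset (Module.Basis.ofVectorSpaceIndex F E) := Finset.univ.biUnion fun rs : n × n => (b.repr (P rs.1 rs.2)).support
  have hT : ∀ r s, (b.repr (P r s)).support ⊆ T := fun r s =>
    Finset.subset_biUnion_of_mem (fun rs : n × n => (b.repr (P rs.1 rs.2)).support) (Finset.mem_univ (r, s))
  have hPexp : ∀ r s, P r s = ∑ k ∈ T, algebraMap F E (Q k r s) * (b k : E) := by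
    intro r s
    have h1 := b.linearCombination_repr (P r s)
    rw [Finsupp.linearCombination_apply, Finsupp.sum_of_support_subset _ (hT r s) _ (fun k _ => zero_smul F (b k))] at h1
    rw [← h1]
    refine Finset.sum_congr rfl fun k _ => ?_
    rw [Algebra.smul_def]
    rfl
  -- the determinant polynomial `f = det (Σ_k y_k · Q_k)` over `F`
  let Φ : Matrix n n (MvPolynomial T F) :=
    ∑ k : T, (MvPolynomial.X k : MvPolynomial T F) • (Q (k : Module.Basis.ofVectorSpaceIndex F E)).map
      (MvPolynomial.C : F →+* MvPolynomial T F)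
  have hΦ_apply : ∀ r s, Φ r s = ∑ k : T, MvPolynomial.X k * MvPolynomial.C (Q (k : _) r s) := by
    intro r s
    simp only [Φ, Matrix.sum_apply, Matrix.smul_apply, Matrix.map_apply, smul_eq_mul]
  -- its value at the `E`-point `(b_k)_k` is `det P ≠ 0`
  have haeval : (MvPolynomial.aeval (fun k : T => (b k : E))).toRingHom.mapMatrix Φ = P := by
    ext r s
    rw [RingHom.mapMatrix_apply, Matrix.map_apply, hΦ_apply, AlgHom.toRingHom_eq_coe, RingHom.coe_coe, map_sum, hPexp r s,
      ← Finset.sum_coe_sort T]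
    refine Finset.sum_congr rfl fun k _ => ?_
    rw [map_mul, MvPolynomial.aeval_X, MvPolynomial.aeval_C, mul_comm]
  have hf : Φ.det ≠ 0 := by
    intro h0
    apply hP
    rw [← haeval, ← RingHom.map_det, h0, map_zero]
  -- `F` infinite ⟹ a non-root `a ∈ F^T`
  obtain ⟨a, ha⟩ : ∃ a : T → F, MvPolynomial.eval a Φ.det ≠ 0 := by
    by_contra hcon
    push Not at hcon
    exact hf (MvPolynomial.funext fun a => by rw [hcon a, map_zero])
  -- `Q₀ := Σ_k a_k · Q_k`
  refine ⟨∑ k : T, a k • Q (k : _), ?_, fun i => ?_⟩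
  · have heval : (MvPolynomial.eval a).mapMatrix Φ = ∑ k : T, a k • Q (k : _) := by
      ext r s
      rw [RingHom.mapMatrix_apply, Matrix.map_apply, hΦ_apply, map_sum, Matrix.sum_apply]
      refine Finset.sum_congr rfl fun k _ => ?_
      rw [map_mul, MvPolynomial.eval_X, MvPolynomial.eval_C, Matrix.smul_apply, smul_eq_mul]
    rwa [← heval, ← RingHom.map_det]
  · rw [Finset.mul_sum, Finset.sum_mul]
    refine Finset.sum_congr rfl fun k _ => ?_
    rw [Matrix.mul_smul, Matrix.smul_mul, hQ]

/-- `X = P · Y · P⁻¹` in `M_n(E)` with `P ∈ GL_n(E)` ⟹ `X · P = P · Y`. [folklore] -/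
theorem mul_eq_mul_of_eq_conj (P : GL n E) (X Y : Matrix n n E)
    (h : X = (P : Matrix n n E) * Y * ((P⁻¹ : GL n E) : Matrix n n E)) : X * (P : Matrix n n E) = (P : Matrix n n E) * Y := by
  rw [h, Matrix.mul_assoc, Matrix.mul_assoc, Units.inv_mul, Matrix.mul_one]

/-- `X · Q = Q · Y` in `M_n(F)` with `Q ∈ GL_n(F)` ⟹ `X = Q · Y · Q⁻¹`. [folklore] -/
theorem eq_conj_of_mul_eq_mul (Q : GL n F) (X Y : Matrix n n F) (h : X * (Q : Matrix n n F) = (Q : Matrix n n F) * Y) :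
    X = (Q : Matrix n n F) * Y * ((Q⁻¹ : GL n F) : Matrix n n F) := by
  rw [← h, Matrix.mul_assoc, Units.mul_inv, Matrix.mul_one]

/-- **Descent of conjugacy (`GL` form).** `F ⊆ E` fields, `F` infinite; if `A_i^E = P · B_i^E · P⁻¹` for every `i` with `P ∈ GL_n(E)`, then
`A_i = Q · B_i · Q⁻¹` for every `i` for some `Q ∈ GL_n(F)`. [folklore] -/
theorem exists_conj_descent_GL [Infinite F] {ι : Type*} (A B : ι → Matrix n n F) (P : GL n E)
    (h : ∀ i, (A i).map (algebraMap F E) =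
      (P : Matrix n n E) * (B i).map (algebraMap F E) * ((P⁻¹ : GL n E) : Matrix n n E)) :
    ∃ Q : GL n F, ∀ i, A i = (Q : Matrix n n F) * B i * ((Q⁻¹ : GL n F) : Matrix n n F) := by
  have hP : (P : Matrix n n E).det ≠ 0 := by
    have hu := (Matrix.isUnit_iff_isUnit_det _).mp P.isUnit
    exact hu.ne_zero
  obtain ⟨Q, hQ, hAQ⟩ := exists_conj_descent A B (P : Matrix n n E) hP (fun i => mul_eq_mul_of_eq_conj P _ _ (h i))
  refine ⟨Matrix.GeneralLinearGroup.mkOfDetNeZero Q hQ, fun i => eq_conj_of_mul_eq_mul _ _ _ ?_⟩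
  have hc : ((Matrix.GeneralLinearGroup.mkOfDetNeZero Q hQ : GL n F) : Matrix n n F) = Q := rfl
  rw [hc]
  exact hAQ i

end LinearAlgebra

/-! ### §3. The Summits bridges: (G-fib₀), (G-fib_t) and `IsBranchGaloisLattice` from conjugacy over an extension field `Ω` -/

section Bridges

variable (W : WeierstrassCurve ℚ) [W.IsElliptic] [W.IsGloballyMinimal] (p : ℕ) [Fact p.Prime]

/-- `ℚ_p` is infinite (characteristic zero). [folklore] -/
theorem infinite_padic : Infinite ℚ_[p] := Infinite.of_injective _ (Nat.cast_injective (R := ℚ_[p]))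

omit [W.IsElliptic] [W.IsGloballyMinimal] in
/-- **(G-fib₀) over `Ω` ⟹ (G-fib₀) over `ℚ_p`.** If the `X = 0` fibre of `ρ : Γ_ℚ →ₜ* GL₂(ℤ_p⟦X⟧)` is conjugate OVER SOME FIELD `Ω ⊇ ℚ_p`
(e.g. `Ω = ℚ̄_p`: Hida's «equivalent as a Galois representation into `GL₂(Ω)`») to `T_pE` in a `ℤ_p`-basis `b`, then it is conjugate to it
OVER `ℚ_p` in the same basis — the registered clause (G-fib₀) of `IsBranchGaloisLattice`, token for token.
[cite: Hida1986, Thm. 2.1 (2.2c) (p. 559)] -/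
theorem fib0_of_conjOver (ρ : FramedGaloisRep ℚ (PowerSeries ℤ_[p]) 2) (Ω : Type*) [Field Ω] [Algebra ℚ_[p] Ω]
    (b : Module.Basis (Fin 2) ℤ_[p] (W.tateModule p)) (P : GL (Fin 2) Ω)
    (h : ∀ σ : Field.absoluteGaloisGroup ℚ,
      (((ρ σ : GL (Fin 2) (PowerSeries ℤ_[p])) : Matrix (Fin 2) (Fin 2) (PowerSeries ℤ_[p])).map
          (fun F : PowerSeries ℤ_[p] => algebraMap ℚ_[p] Ω ((PowerSeries.constantCoeff F : ℤ_[p]) : ℚ_[p]))) =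
        ((P : GL (Fin 2) Ω) : Matrix (Fin 2) (Fin 2) Ω) *
          (LinearMap.toMatrix b b (W.galoisRepTate p σ)).map (fun z : ℤ_[p] => algebraMap ℚ_[p] Ω (z : ℚ_[p])) *
          ((P⁻¹ : GL (Fin 2) Ω) : Matrix (Fin 2) (Fin 2) Ω)) :
    ∃ (b : Module.Basis (Fin 2) ℤ_[p] (W.tateModule p)) (P : GL (Fin 2) ℚ_[p]),
      ∀ σ : Field.absoluteGaloisGroup ℚ,
        (((ρ σ : GL (Fin 2) (PowerSeries ℤ_[p])) : Matrix (Fin 2) (Fin 2) (PowerSeries ℤ_[p])).map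
            (fun F : PowerSeries ℤ_[p] => ((PowerSeries.constantCoeff F : ℤ_[p]) : ℚ_[p]))) =
          ((P : GL (Fin 2) ℚ_[p]) : Matrix (Fin 2) (Fin 2) ℚ_[p]) *
            (LinearMap.toMatrix b b (W.galoisRepTate p σ)).map (fun z : ℤ_[p] => (z : ℚ_[p])) *
            ((P⁻¹ : GL (Fin 2) ℚ_[p]) : Matrix (Fin 2) (Fin 2) ℚ_[p]) := by
  haveI : Infinite ℚ_[p] := infinite_padic p
  let A : Field.absoluteGaloisGroup ℚ → Matrix (Fin 2) (Fin 2) ℚ_[p] := fun σ =>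
    (((ρ σ : GL (Fin 2) (PowerSeries ℤ_[p])) : Matrix (Fin 2) (Fin 2) (PowerSeries ℤ_[p])).map
      (fun F : PowerSeries ℤ_[p] => ((PowerSeries.constantCoeff F : ℤ_[p]) : ℚ_[p])))
  let B : Field.absoluteGaloisGroup ℚ → Matrix (Fin 2) (Fin 2) ℚ_[p] := fun σ =>
    (LinearMap.toMatrix b b (W.galoisRepTate p σ)).map (fun z : ℤ_[p] => (z : ℚ_[p]))
  have hAB : ∀ σ, (A σ).map (algebraMap ℚ_[p] Ω) =
      (P : Matrix (Fin 2) (Fin 2) Ω) * (B σ).map (algebraMap ℚ_[p] Ω) * ((P⁻¹ : GL (Fin 2) Ω) : Matrix (Fin 2) (Fin 2) Ω) := by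
    intro σ
    rw [Matrix.map_map, Matrix.map_map]
    exact h σ
  obtain ⟨Q, hQ⟩ := exists_conj_descent_GL A B P hAB
  exact ⟨b, Q, hQ⟩

variable {p}

/-- **(G-fib_t) over `Ω` ⟹ (G-fib_t) over `K_t`.** For the member datum `Δ : OrdinaryNewformDatum g p ι` (`K_t = padicCoeffField ι ⊆ ℚ̄_p`,
`𝒪_t = padicCoeffIntegers ι`): if the `ℤ_p`-matrices `M σ` are conjugate OVER SOME FIELD `Ω ⊇ K_t ⊇ ℚ_p` (e.g. `Ω = ℚ̄_p`) to
`Δ.selfDualRep σ`, then they are conjugate to it OVER `K_t` — the second conjunct of the registered clause (G-fib_t), token for token.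
[cite: Hida1986, Thm. 2.1 (2.2c) (p. 559)] -/
theorem fibt_of_conjOver {M' : ℕ} {k' : ℤ} {g' : CuspForm (CongruenceSubgroup.Gamma0 M') k'} {ι' : coeffField g' →+* PadicAlgCl p}
    (Δ : OrdinaryNewformDatum g' p ι') (Ω : Type*) [Field Ω] [Algebra ℚ_[p] Ω] [Algebra (padicCoeffField ι') Ω]
    [IsScalarTower ℚ_[p] (padicCoeffField ι') Ω]
    (M : Field.absoluteGaloisGroup ℚ → Matrix (Fin 2) (Fin 2) ℤ_[p]) (P : GL (Fin 2) Ω)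
    (h : ∀ σ : Field.absoluteGaloisGroup ℚ,
      (M σ).map (fun z : ℤ_[p] => algebraMap ℚ_[p] Ω (z : ℚ_[p])) =
        ((P : GL (Fin 2) Ω) : Matrix (Fin 2) (Fin 2) Ω) *
          (((Δ.selfDualRep σ : GL (Fin 2) (padicCoeffIntegers ι')) : Matrix (Fin 2) (Fin 2) (padicCoeffIntegers ι')).map
            (fun z : padicCoeffIntegers ι' => algebraMap (padicCoeffField ι') Ω (z : padicCoeffField ι'))) *
          ((P⁻¹ : GL (Fin 2) Ω) : Matrix (Fin 2) (Fin 2) Ω)) :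
    ∃ P : GL (Fin 2) (padicCoeffField ι'),
      ∀ σ : Field.absoluteGaloisGroup ℚ,
        (M σ).map (fun z : ℤ_[p] => algebraMap ℚ_[p] (padicCoeffField ι') (z : ℚ_[p])) =
          ((P : GL (Fin 2) (padicCoeffField ι')) : Matrix (Fin 2) (Fin 2) (padicCoeffField ι')) *
            (((Δ.selfDualRep σ : GL (Fin 2) (padicCoeffIntegers ι')) : Matrix (Fin 2) (Fin 2) (padicCoeffIntegers ι')).map
              (fun z : padicCoeffIntegers ι' => (z : padicCoeffField ι'))) *
            ((P⁻¹ : GL (Fin 2) (padicCoeffField ι')) : Matrix (Fin 2) (Fin 2) (padicCoeffField ι')) := by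
  haveI : Infinite (padicCoeffField ι') := Infinite.of_injective _ (Nat.cast_injective (R := padicCoeffField ι'))
  let A : Field.absoluteGaloisGroup ℚ → Matrix (Fin 2) (Fin 2) (padicCoeffField ι') := fun σ =>
    (M σ).map (fun z : ℤ_[p] => algebraMap ℚ_[p] (padicCoeffField ι') (z : ℚ_[p]))
  let B : Field.absoluteGaloisGroup ℚ → Matrix (Fin 2) (Fin 2) (padicCoeffField ι') := fun σ =>
    (((Δ.selfDualRep σ : GL (Fin 2) (padicCoeffIntegers ι')) : Matrix (Fin 2) (Fin 2) (padicCoeffIntegers ι')).map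
      (fun z : padicCoeffIntegers ι' => (z : padicCoeffField ι')))
  have hAB : ∀ σ, (A σ).map (algebraMap (padicCoeffField ι') Ω) =
      (P : Matrix (Fin 2) (Fin 2) Ω) * (B σ).map (algebraMap (padicCoeffField ι') Ω) *
        ((P⁻¹ : GL (Fin 2) Ω) : Matrix (Fin 2) (Fin 2) Ω) := by
    intro σ
    rw [Matrix.map_map, Matrix.map_map]
    have hA : ((algebraMap (padicCoeffField ι') Ω) ∘ fun z : ℤ_[p] => algebraMap ℚ_[p] (padicCoeffField ι') (z : ℚ_[p])) =
        fun z : ℤ_[p] => algebraMap ℚ_[p] Ω (z : ℚ_[p]) := by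
      funext z
      simp only [Function.comp_apply]
      rw [← IsScalarTower.algebraMap_apply]
    rw [hA]
    exact h σ
  obtain ⟨Q, hQ⟩ := exists_conj_descent_GL A B P hAB
  exact ⟨Q, hQ⟩

variable (p)

set_option maxHeartbeats 800000 in
/-- **`IsBranchGaloisLattice` from its clauses READ OVER AN EXTENSION FIELD `Ω`** (e.g. `Ω = ℚ̄_p = PadicAlgCl p`, Hida's coefficient field
of «equivalent as a Galois representation into `GL₂(Ω)`», [Hida1986] p. 558/559): (G-unr) verbatim ∧ (G-fib₀) with the conjugating matrix in
`GL₂(Ω)` ∧ (G-fib_t) with the member's conjugating matrix in `GL₂(Ω)` ∧ (G-rat) verbatim ⟹ `IsBranchGaloisLattice W p x D ρ` (conjugacy over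
`ℚ_p`, resp. `K_t`). This is transcription step (D5) «Ribet + Schur» of the assembled fact T-An-2ᵍ DISCHARGED as a tree theorem — and without
any irreducibility input. [cite: Hida1986, §2 Terminology (p. 558), Thm. 2.1 (2.2b) (2.2c) (p. 559)] -/
theorem isBranchGaloisLattice_of_conjOver (x : ℕ → ℤ_[p]) (D : ℕ → Skinner2016.HidaCongruentForm W p 1)
    (ρ : FramedGaloisRep ℚ (PowerSeries ℤ_[p]) 2) (Ω : Type*) [Field Ω] [Algebra ℚ_[p] Ω]
    [∀ t : ℕ, Algebra (padicCoeffField (D t).ι) Ω] [∀ t : ℕ, IsScalarTower ℚ_[p] (padicCoeffField (D t).ι) Ω]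
    -- (G-unr) verbatim
    (hunr : ∀ v : IsDedekindDomain.HeightOneSpectrum (NumberField.RingOfIntegers ℚ),
      ¬ ((Rat.HeightOneSpectrum.primesEquiv v : Nat.Primes) : ℕ) ∣ W.conductorNorm ℤ → ρ.IsUnramifiedAt v)
    -- (G-fib₀) over `Ω`
    (hfib0 : ∃ (b : Module.Basis (Fin 2) ℤ_[p] (W.tateModule p)) (P : GL (Fin 2) Ω),
      ∀ σ : Field.absoluteGaloisGroup ℚ,
        (((ρ σ : GL (Fin 2) (PowerSeries ℤ_[p])) : Matrix (Fin 2) (Fin 2) (PowerSeries ℤ_[p])).map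
            (fun F : PowerSeries ℤ_[p] => algebraMap ℚ_[p] Ω ((PowerSeries.constantCoeff F : ℤ_[p]) : ℚ_[p]))) =
          ((P : GL (Fin 2) Ω) : Matrix (Fin 2) (Fin 2) Ω) *
            (LinearMap.toMatrix b b (W.galoisRepTate p σ)).map (fun z : ℤ_[p] => algebraMap ℚ_[p] Ω (z : ℚ_[p])) *
            ((P⁻¹ : GL (Fin 2) Ω) : Matrix (Fin 2) (Fin 2) Ω))
    -- (G-fib_t) with the conjugacy over `Ω`
    (hfibt : ∀ t : ℕ, ∃ (M : Field.absoluteGaloisGroup ℚ → Matrix (Fin 2) (Fin 2) ℤ_[p])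
        (U : Field.absoluteGaloisGroup ℚ → Matrix (Fin 2) (Fin 2) (PowerSeries ℤ_[p])) (P : GL (Fin 2) Ω),
      ∀ σ : Field.absoluteGaloisGroup ℚ,
        (((ρ σ : GL (Fin 2) (PowerSeries ℤ_[p])) : Matrix (Fin 2) (Fin 2) (PowerSeries ℤ_[p])) =
          (M σ).map (PowerSeries.C (R := ℤ_[p])) + (PowerSeries.X - PowerSeries.C (x t)) • U σ) ∧
        (M σ).map (fun z : ℤ_[p] => algebraMap ℚ_[p] Ω (z : ℚ_[p])) =
          ((P : GL (Fin 2) Ω) : Matrix (Fin 2) (Fin 2) Ω) *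
            ((((D t).Δ.selfDualRep σ : GL (Fin 2) (padicCoeffIntegers (D t).ι)) :
                Matrix (Fin 2) (Fin 2) (padicCoeffIntegers (D t).ι)).map
              (fun z : padicCoeffIntegers (D t).ι => algebraMap (padicCoeffField (D t).ι) Ω (z : padicCoeffField (D t).ι))) *
            ((P⁻¹ : GL (Fin 2) Ω) : Matrix (Fin 2) (Fin 2) Ω))
    -- (G-rat) verbatim
    (hrat : ∀ t : ℕ, Function.Surjective (algebraMap ℤ_[p] (padicCoeffIntegers (D t).ι))) :
    IsBranchGaloisLattice W p x D ρ := by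
  refine ⟨hunr, ?_, fun t => ?_, hrat⟩
  · obtain ⟨b, P, h⟩ := hfib0
    exact fib0_of_conjOver W p ρ Ω b P h
  · obtain ⟨M, U, P, h⟩ := hfibt t
    obtain ⟨Q, hQ⟩ := fibt_of_conjOver (D t).Δ Ω M P (fun σ => (h σ).2)
    exact ⟨M, U, Q, fun σ => ⟨(h σ).1, hQ σ⟩⟩

end Bridges

end Summit.BirchSwinnertonDyer.BirchSwinnertonDyer.Theorems.TelescopeBranchConjDescent

end
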